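import Summits.Ventures.PercRepro.C041TriangleTypeFamily

/-!
# THE TRIANGLE WITH `p` MARKS OF TYPE 1 AT ONE EXIT AND `q` OF TYPE 2 AT THE OTHER IS IN THE CONE, FOR ALL `p, q ≥ 1`
(mine-3, gen 59; C-041.md §21 (ad))

A second infinite family of the cone form: with `A = 2^p`,
  `θ_△(X(p,0), X(0,1)) = (5/3)·1 + 4·v ½ + (16/3)·(v ½)² + 2·v 0 + 2·v 1 + (4A − 8)·v 1 * v ½`
— an identity of six-vectors polynomial in `A` (`thetaTri_pow_one_v_zero`; the fixed support read off the exact LP at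
`p = 2, 3` and confirmed by the exact solve at `p = 1 … 8`: the last coefficient is `0, 8, 24, 56, 120, 248, 504, 1016 =
4·(2^p − 2)`).  Every coefficient is non-negative for `p ≥ 1`, so the triangle lies in the cone
(`InCone_thetaTri_pow_one_v_zero`), and so does every two-exit cycle carrying these vertices
(`InCone_thetaCyc_pow_one_v_zero`); the mirror `X(1,0) × X(0,q)` follows by the type swap (`InCone_thetaTri_v_one_pow_zero`,
proved the same way).  Here the fugacity-deformed leaf `v ½` is indispensable (the marks-only LP is infeasible, C-041.md
§21 (ac)).  THE WHOLE FAMILY: for `p, q ≥ 2` the two-parameter identity `θ_△(X(p,0), X(0,q)) = 3·1 + 8·v 0 + 8·v 1 +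
((A − 2)(B − 2) + 12)·X(1,1) + (4A − 16)·v 1 * v ½ + (4B − 16)·v 0 * v ½` (`A = 2^p`, `B = 2^q`; `thetaTri_pow_one_pow_zero_gen`)
has non-negative coefficients, and with the `q = 1` / `p = 1` edges above every pair of opposite-type marked vertices of any
multiplicities has its triangle (`InCone_thetaTri_type_pair`) and every two-exit cycle (`InCone_thetaCyc_type_pair`) in the
cone — the complete «first hard instance» family of C-041.md §21 (f).
-/

namespace PercRepro

namespace RelaxedTriangle

open TreeClosure

/-- **THE FAMILY IDENTITY**: `θ_△(X(p,0), X(0,1)) = (5/3)·1 + 4·v ½ + (16/3)·(v ½)² + 2·v 0 + 2·v 1 + (4·2^p − 8)·v 1 * v ½`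
for every `p ≥ 1`. -/
theorem thetaTri_pow_one_v_zero (p : ℕ) (hp : 1 ≤ p) :
    thetaTri (v 1 ^ p) (v 0) = (5 / 3 : ℝ) • (1 : Vec6) + (4 : ℝ) • v (1 / 2) + (16 / 3 : ℝ) • (v (1 / 2) * v (1 / 2))
      + (2 : ℝ) • v 0 + (2 : ℝ) • v 1 + (4 * (2 : ℝ) ^ p - 8) • (v 1 * v (1 / 2)) := by
  rw [pow_v_one_eq p hp]
  ext i
  simp only [thetaTri_eq_vec, Pi.add_apply, Pi.smul_apply, Pi.mul_apply, Pi.one_apply, smul_eq_mul, v]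
  fin_cases i <;> simp <;> ring

/-- The mirror identity: `θ_△(X(1,0), X(0,q)) = (5/3)·1 + 4·v ½ + (16/3)·(v ½)² + 2·v 0 + 2·v 1 + (4·2^q − 8)·v 0 * v ½`. -/
theorem thetaTri_v_one_pow_zero (q : ℕ) (hq : 1 ≤ q) :
    thetaTri (v 1) (v 0 ^ q) = (5 / 3 : ℝ) • (1 : Vec6) + (4 : ℝ) • v (1 / 2) + (16 / 3 : ℝ) • (v (1 / 2) * v (1 / 2))
      + (2 : ℝ) • v 0 + (2 : ℝ) • v 1 + (4 * (2 : ℝ) ^ q - 8) • (v 0 * v (1 / 2)) := by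
  rw [pow_v_zero_eq q hq]
  ext i
  simp only [thetaTri_eq_vec, Pi.add_apply, Pi.smul_apply, Pi.mul_apply, Pi.one_apply, smul_eq_mul, v]
  fin_cases i <;> simp <;> ring

/-- `2^p ≥ 2` for `p ≥ 1`. -/
theorem two_le_two_pow (p : ℕ) (hp : 1 ≤ p) : (2 : ℝ) ≤ 2 ^ p := by
  have : (2 : ℝ) ^ 1 ≤ 2 ^ p := pow_le_pow_right₀ (by norm_num) hp
  linarith

/-- The deformed `(1,1)`-leaf `v ½` lies in the cone. -/
theorem InCone_vh : InCone (v (1 / 2)) := InCone_v (1 / 2) ⟨by norm_num, by norm_num⟩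

/-- **THEOREM (TRIANGLE, `p` marks of type 1 against one mark of type 2)**: in the cone for every `p ≥ 1`. -/
theorem InCone_thetaTri_pow_one_v_zero (p : ℕ) (hp : 1 ≤ p) : InCone (thetaTri (v 1 ^ p) (v 0)) := by
  rw [thetaTri_pow_one_v_zero p hp]
  have h2 := two_le_two_pow p hp
  refine (((((InCone.smul _ (by norm_num) InCone_one).add (InCone.smul _ (by norm_num) InCone_vh)).add
    (InCone.smul _ (by norm_num) (InCone_vh.mul InCone_vh))).add (InCone.smul _ (by norm_num) InCone_v0)).add
    (InCone.smul _ (by norm_num) InCone_v1)).add (InCone.smul _ (by linarith) (InCone_v1.mul InCone_vh))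

/-- The mirror: `X(1,0)` against `q` marks of type 2, in the cone for every `q ≥ 1`. -/
theorem InCone_thetaTri_v_one_pow_zero (q : ℕ) (hq : 1 ≤ q) : InCone (thetaTri (v 1) (v 0 ^ q)) := by
  rw [thetaTri_v_one_pow_zero q hq]
  have h2 := two_le_two_pow q hq
  refine (((((InCone.smul _ (by norm_num) InCone_one).add (InCone.smul _ (by norm_num) InCone_vh)).add
    (InCone.smul _ (by norm_num) (InCone_vh.mul InCone_vh))).add (InCone.smul _ (by norm_num) InCone_v0)).add
    (InCone.smul _ (by norm_num) InCone_v1)).add (InCone.smul _ (by linarith) (InCone_v0.mul InCone_vh))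

/-- **Every two-exit cycle with `p` marks of type 1 at one vertex and a single mark of type 2 at the other lies in the cone.** -/
theorem InCone_thetaCyc_pow_one_v_zero (p₀ : ℕ) (hp₀ : 1 ≤ p₀) {p q s : ℝ} (hp : 0 ≤ p) (hq : 0 ≤ q) (hs : 0 ≤ s) :
    InCone (thetaCyc p q s (v 1 ^ p₀) (v 0)) :=
  InCone_thetaCyc_of_InCone_tri (InCone_pow_v_one p₀) InCone_v0 (InCone_thetaTri_pow_one_v_zero p₀ hp₀) hp hq hs

/-- The mirror cycle statement. -/
theorem InCone_thetaCyc_v_one_pow_zero (q₀ : ℕ) (hq₀ : 1 ≤ q₀) {p q s : ℝ} (hp : 0 ≤ p) (hq : 0 ≤ q) (hs : 0 ≤ s) :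
    InCone (thetaCyc p q s (v 1) (v 0 ^ q₀)) :=
  InCone_thetaCyc_of_InCone_tri InCone_v1 (InCone_pow_v_zero q₀) (InCone_thetaTri_v_one_pow_zero q₀ hq₀) hp hq hs

/-! ## The whole family: `p` marks of type 1 against `q` marks of type 2, every `p, q ≥ 1` -/

/-- **THE TWO-PARAMETER IDENTITY**: with `A = 2^p`, `B = 2^q`,
`θ_△(X(p,0), X(0,q)) = 3·1 + 8·v 0 + 8·v 1 + ((A − 2)(B − 2) + 12)·X(1,1) + (4A − 16)·v 1 * v ½ + (4B − 16)·v 0 * v ½`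
for all `p, q ≥ 1` (read off the exact LP on the fixed support at `p, q ≤ 5`, proved for all `p, q`). -/
theorem thetaTri_pow_one_pow_zero_gen (p q : ℕ) (hp : 1 ≤ p) (hq : 1 ≤ q) :
    thetaTri (v 1 ^ p) (v 0 ^ q) = (3 : ℝ) • (1 : Vec6) + (8 : ℝ) • v 0 + (8 : ℝ) • v 1
      + (((2 : ℝ) ^ p - 2) * ((2 : ℝ) ^ q - 2) + 12) • (v 1 * v 0)
      + (4 * (2 : ℝ) ^ p - 16) • (v 1 * v (1 / 2)) + (4 * (2 : ℝ) ^ q - 16) • (v 0 * v (1 / 2)) := by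
  rw [pow_v_one_eq p hp, pow_v_zero_eq q hq]
  ext i
  simp only [thetaTri_eq_vec, Pi.add_apply, Pi.smul_apply, Pi.mul_apply, Pi.one_apply, smul_eq_mul, v]
  fin_cases i <;> simp <;> ring

/-- **THEOREM (TRIANGLE, `p` marks of type 1 against `q` of type 2, `p, q ≥ 2`)**: in the cone. -/
theorem InCone_thetaTri_pow_one_pow_zero_gen (p q : ℕ) (hp : 2 ≤ p) (hq : 2 ≤ q) :
    InCone (thetaTri (v 1 ^ p) (v 0 ^ q)) := by
  rw [thetaTri_pow_one_pow_zero_gen p q (by omega) (by omega)]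
  have hA := four_le_two_pow p hp
  have hB := four_le_two_pow q hq
  refine (((((InCone.smul _ (by norm_num) InCone_one).add (InCone.smul _ (by norm_num) InCone_v0)).add
    (InCone.smul _ (by norm_num) InCone_v1)).add
    (InCone.smul _ (by nlinarith) InCone_X11)).add
    (InCone.smul _ (by linarith) (InCone_v1.mul InCone_vh))).add
    (InCone.smul _ (by linarith) (InCone_v0.mul InCone_vh))

/-- **THEOREM (TRIANGLE, two opposite-type marked vertices of ANY multiplicities)**: for all `p, q ≥ 1` the triangle
with `X(p, 0)` and `X(0, q)` at its exits lies in the cone — the whole «first hard instance» family of C-041.md §21 (f). -/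
theorem InCone_thetaTri_type_pair (p q : ℕ) (hp : 1 ≤ p) (hq : 1 ≤ q) : InCone (thetaTri (v 1 ^ p) (v 0 ^ q)) := by
  rcases Nat.lt_or_ge p 2 with h1 | h1
  · have e : p = 1 := by omega
    subst e
    simpa using InCone_thetaTri_v_one_pow_zero q hq
  · rcases Nat.lt_or_ge q 2 with h2 | h2
    · have e : q = 1 := by omega
      subst e
      simpa using InCone_thetaTri_pow_one_v_zero p hp
    · exact InCone_thetaTri_pow_one_pow_zero_gen p q h1 h2

/-- **Every two-exit cycle with `p` marks of type 1 at one vertex and `q` of type 2 at the other (`p, q ≥ 1`, any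
length, any positions, any multiplicities) lies in the cone.** -/
theorem InCone_thetaCyc_type_pair (p₀ q₀ : ℕ) (hp₀ : 1 ≤ p₀) (hq₀ : 1 ≤ q₀) {p q s : ℝ} (hp : 0 ≤ p) (hq : 0 ≤ q)
    (hs : 0 ≤ s) : InCone (thetaCyc p q s (v 1 ^ p₀) (v 0 ^ q₀)) :=
  InCone_thetaCyc_of_InCone_tri (InCone_pow_v_one p₀) (InCone_pow_v_zero q₀) (InCone_thetaTri_type_pair p₀ q₀ hp₀ hq₀)
    hp hq hs

end RelaxedTriangle

end PercRepro
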